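import Summits.HodgeConjecture.HodgeConjecture.Theorems.Ring2AbelianAllAndreSquareDegrees
import Literature.AlgebraicGeometry.HodgeTheory.CurveCorrespondencePushforward
import Literature.AlgebraicTopology.CharacteristicClasses.ProjectiveBundleTrivialisedLerayHirsch
import HarnessLib

/-!
# Ring 2 · sub-cell AbelianAll (ALL ABELIAN VARIETIES), André axis, part XXXVII-g₀ — WEIGHT SHIFTS OF THE RELATIVE CORRESPONDENCES OF THE
# FIBRE SQUARE: `ν_* Γ_Q ν^* = Γ_{(θ₁θ₂)_* Q}`, `(θ₁θ₂)_* 1 = N^{4d}`, `[pr₁^* p ∪ γ]_* = p ∪ [γ]_*`, cup powers and eigenvector bookkeeping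

HONEST FRAMING (page 1, verbatim): **research route, not a corollary; conditional on HC_CM plus one named
minimal statement.** Cell line: research route conditional on HC_CM; not a corollary; Q11.4-sentence-2
already refuted in dim ≥ 3. This file does NOT prove `B(X)` for any new `X` and does NOT
touch `HC_CM`.

Gen-29 file of the `ab-andre-2` seat (cell `pub-hodge-ring2`, sub-cell AbelianAll = ALL abelian varieties, not Weil-type-only).

## What this file proves (sorry-free, standard axioms only)

Bookkeeping for part XXXVII-g (the middle block `(ρ) = R₁` of ring2-b05 from one class on the fibre square `𝒴 = 𝒳 ×_S 𝒳`):
* §1 `eq_zero_of_eigen_of_eq_add` (eigenvectors of distinct eigenvalues are independent, three terms), `aeval_apply_of_forall_eq_smul`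
  (`P(T) z = P(c) z` for a scalar operator), `complexBetti_map_cupPow`, `map_cupPow_eq_smul_of_map_eq_smul` (`ν^* η = N² η ⟹ ν^* ηʲ = N^{2j} ηʲ`),
  `corrAction_cupProduct_map_fst` (`[pr₁^* p ∪ γ]_* c = p ∪ [γ]_* c` for `p` of even degree — projection formula).
* §2 `gysin_squareCorr_map` — **`ν_* ∘ Γ_Q ∘ ν^* = Γ_{(θ₁θ₂)_* Q}`** for the relative correspondences `Γ_Q(y) = a_*(b^* y ∪ Q)` of the square
  (exact: functoriality of Gysin maps and the projection formula; the lower Leray parts of a class SHIFT weights), and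
  `gysin_squareEndo_comp_one` — `(θ₁θ₂)_* 1 = N^{2d} N^{2d} · 1`.

## Documentary interface — PRINT / LEAN / GAP

PRINT: Fulton, *Young tableaux*, App. B §B.1 (5)–(6); Fulton, *Intersection theory*, Example 1.7.4, §16.1; Hatcher §3.2. LEAN: the displayed
theorems, fact-free. GAP: none (service lemmas for parts XXXVII-g₂/g₃).
-/

noncomputable section

set_option linter.dupNamespace false

namespace Summit.HodgeConjecture.HodgeConjecture.Ring2.AbelianAll

open CategoryTheory CategoryTheory.Limits AlgebraicGeometry MonoidalCategory CartesianMonoidalCategory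
open Literature.AlgebraicGeometry Literature.AlgebraicGeometry.Motives
open Literature.AlgebraicGeometry.HodgeTheory
open Literature.AlgebraicTopology.SingularHomology (singularCohomology cupProduct cupProduct_map cupProduct_one one_cupProduct
  cupProduct_assoc cupProduct_gradedComm_holds)
open Literature.AlgebraicTopology.CharacteristicClasses (cupPow cupPow_succ map_cupPow cupPow_smul)
open Summit.HodgeConjecture.HodgeConjecture.Theorems (deg_fiberGysin_aux)

/-! ## §1 Linear-algebra and cup-power bookkeeping -/

section Prelim

variable {K V : Type*} [Field K] [AddCommGroup V] [Module K V]

/-- **Eigenvectors of distinct eigenvalues are independent (three terms)**: if `T x = α x`, `x = v + v'` with `T v = β v`, `T v' = γ v'`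
and `α ≠ β`, `α ≠ γ`, then `x = 0` (apply `(T - β)(T - γ)`). [cite: Kleiman1968AlgebraicCycles, §1.4] -/
theorem eq_zero_of_eigen_of_eq_add (T : Module.End K V) {α β γ : K} (hαβ : α ≠ β) (hαγ : α ≠ γ) {x v v' : V} (hx : T x = α • x)
    (hv : T v = β • v) (hv' : T v' = γ • v') (h : x = v + v') : x = 0 := by
  have h1 : T (T x) - (β + γ) • T x + (β * γ) • x = ((α - β) * (α - γ)) • x := by
    rw [hx, map_smul, hx, smul_smul]
    module
  have h2 : T (T x) - (β + γ) • T x + (β * γ) • x = 0 := by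
    rw [h, map_add, hv, hv', map_add, map_smul, map_smul, hv, hv', smul_smul, smul_smul]
    module
  rw [h2] at h1
  exact (smul_eq_zero.1 h1.symm).resolve_left (mul_ne_zero (sub_ne_zero.2 hαβ) (sub_ne_zero.2 hαγ))

/-- **A polynomial in a scalar operator**: if `T z = c z` for all `z` then `P(T) z = P(c) z`. [folklore] -/
theorem aeval_apply_of_forall_eq_smul (T : Module.End K V) {c : K} (hT : ∀ z, T z = c • z) (P : Polynomial K) (z : V) :
    Polynomial.aeval T P z = P.eval c • z := by
  induction P using Polynomial.induction_on' with
  | add p q hp hq => rw [map_add, LinearMap.add_apply, hp, hq, Polynomial.eval_add, add_smul]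
  | monomial k a =>
    rw [Polynomial.aeval_monomial, Module.End.mul_apply, Module.algebraMap_end_apply, Polynomial.eval_monomial, mul_smul]
    congr 1
    induction k with
    | zero => rw [pow_zero, pow_zero, Module.End.one_apply, one_smul]
    | succ k ih => rw [pow_succ, Module.End.mul_apply, hT, map_smul, ih, smul_smul, pow_succ']

end Prelim

section CupPow

variable {X Y : SchemeOver ℂ}

/-- `φ^*(xʲ) = (φ^* x)ʲ` for the tree's `complexBetti.map`. [cite: HatcherAT2002, Prop. 3.10] -/
theorem complexBetti_map_cupPow (φ : X ⟶ Y) (x : complexBetti Y 2) (j : ℕ) :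
    complexBetti.map φ (2 * j) (cupPow ℂ x j) = cupPow ℂ (complexBetti.map φ 2 x) j :=
  map_cupPow ℂ _ x j

/-- `ν^* x = N² x ⟹ ν^*(xʲ) = N^{2j} xʲ`. [cite: HatcherAT2002, §3.2 p. 212] -/
theorem map_cupPow_eq_smul_of_map_eq_smul (ν : X ⟶ X) {N : ℕ} {x : complexBetti X 2}
    (hx : complexBetti.map ν 2 x = ((N : ℂ) ^ 2) • x) (j : ℕ) :
    complexBetti.map ν (2 * j) (cupPow ℂ x j) = ((N : ℂ) ^ (2 * j)) • cupPow ℂ x j := by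
  rw [complexBetti_map_cupPow, hx, cupPow_smul, ← pow_mul]

end CupPow


section FibreCup

variable {X : SchemeOver ℂ} {n : ℕ}

/-- **`[pr₁^* p ∪ γ]_* c = p ∪ [γ]_* c`** for a class `p` of even degree: `pr_{1*}(pr₂^* c ∪ (pr₁^* p ∪ γ)) = pr_{1*}(pr₁^* p ∪ (pr₂^* c ∪ γ))
= p ∪ pr_{1*}(pr₂^* c ∪ γ)` (graded commutativity, projection formula). [cite: FultonYoungTableaux1997, Appendix B §B.1 (6)]
[cite: VoisinHodgeII2003, proof of Thm. 10.17 (10.7)] -/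
theorem corrAction_cupProduct_map_fst (μ : OrientationFamily) (hX : IsSmoothProjective n X) {i e e' a b b' : ℕ} (hie : i + 2 * e = 2 * e')
    (hab : a + 2 * e = b + 2 * n) (hab' : a + 2 * e' = b' + 2 * n) (hib : i + b = b') (hi : Even i) (p : complexBetti X i)
    (γ : complexBetti (X ⊗ X) (2 * e)) (c : complexBetti X a) :
    corrAction μ hX hX hab' (cupProduct hie (complexBetti.map (fst X X) i p) γ) c = cupProduct hib p (corrAction μ hX hX hab γ c) := by
  have hμ : μ.HasPoincareDuality := OrientationFamily.hasPoincareDuality μ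
  have hXX := IsSmoothProjective.tensor_holds hX hX
  rw [corrAction_apply, corrAction_apply,
    ← cupProduct_assoc (rfl : a + i = a + i) hie (show a + i + 2 * e = a + 2 * e' by omega) rfl (complexBetti.map (snd X X) a c)
      (complexBetti.map (fst X X) i p) γ,
    cupProduct_gradedComm_holds ℂ (ComplexPoints (X ⊗ X)) (rfl : a + i = a + i) (show i + a = a + i by ring),
    show ((-1 : ℂ) ^ (a * i)) = 1 from Even.neg_one_pow (hi.mul_left a), one_smul,
    cupProduct_assoc (show i + a = a + i by ring) rfl (show a + i + 2 * e = a + 2 * e' by omega)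
      (show i + (a + 2 * e) = a + 2 * e' by omega),
    complexGysin_cup hμ hXX hX (fst X X) (show i + (a + 2 * e) = a + 2 * e' by omega) (corrAction_degree n hab') (corrAction_degree n hab) hib]

end FibreCup

/-! ## §2 Weight shifts of the relative correspondences `Γ_Q(y) = a_*(b^* y ∪ Q)` -/

section Shift


variable {𝒳 S : SchemeOver ℂ} {m : ℕ} {f : 𝒳 ⟶ S}

/-- `𝒴` — the fibre square `𝒳 ×_S 𝒳` (display notation for the tree's `familyPullback f f`). -/
local notation3 (prettyPrint := false) "𝒴[" f "]" => familyPullback f f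
/-- `𝐚` — the first projection `𝒳 ×_S 𝒳 ⟶ 𝒳`. -/
local notation3 (prettyPrint := false) "𝐚[" f "]" => familyPullback.fst f f
/-- `𝐛` — the second projection `𝒳 ×_S 𝒳 ⟶ 𝒳` (the pencil structure of the square is `𝐛 ≫ f`). -/
local notation3 (prettyPrint := false) "𝐛[" f "]" => familyPullback.snd f f
/-- `hY⟦hf⟧` — the square is a smooth projective `(2d+1)`-fold (part XXXVI-c). -/
local notation3 (prettyPrint := false) "hY⟦" hf "⟧" =>
  IsCompactAbelianPencil.isSmoothProjective_total (isCompactAbelianPencil_square hf rfl)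

/-- **`ν_* ∘ Γ_Q ∘ ν^* = Γ_{(θ₁θ₂)_* Q}`**: `ν_* a_*(b^* ν^* y ∪ Q) = a_* (θ₁θ₂)_*((θ₁θ₂)^* b^* y ∪ Q) = a_*(b^* y ∪ (θ₁θ₂)_* Q)`
(`a θ₁θ₂ = ν a`, `b θ₁θ₂ = ν b`, functoriality, projection formula). [cite: FultonYoungTableaux1997, Appendix B §B.1 (5)–(6)] -/
theorem gysin_squareCorr_map (hf : IsCompactAbelianPencil f (m + 1)) (ν : 𝒳 ⟶ 𝒳) {θ₁ θ₂ : 𝒴[f] ⟶ 𝒴[f]}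
    (h1a : θ₁ ≫ 𝐚[f] = 𝐚[f] ≫ ν) (h1b : θ₁ ≫ 𝐛[f] = 𝐛[f]) (h2a : θ₂ ≫ 𝐚[f] = 𝐚[f]) (h2b : θ₂ ≫ 𝐛[f] = 𝐛[f] ≫ ν)
    {k n kn c : ℕ} (hkn : k + n = kn) (hc : kn + 2 * (m + 1 + 1) = c + 2 * (m + 1 + (m + 1) + 1))
    (Q : complexBetti 𝒴[f] n) (y : complexBetti 𝒳 k) :
    complexGysin complexOrientationFamily hf.isSmoothProjective_total hf.isSmoothProjective_total ν
        (rfl : c + 2 * (m + 1 + 1) = c + 2 * (m + 1 + 1))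
      (complexGysin complexOrientationFamily hY⟦hf⟧ hf.isSmoothProjective_total 𝐚[f] hc
        (cupProduct hkn (complexBetti.map 𝐛[f] k (complexBetti.map ν k y)) Q)) =
      complexGysin complexOrientationFamily hY⟦hf⟧ hf.isSmoothProjective_total 𝐚[f] hc
        (cupProduct hkn (complexBetti.map 𝐛[f] k y)
          (complexGysin complexOrientationFamily hY⟦hf⟧ hY⟦hf⟧ (θ₁ ≫ θ₂)
            (rfl : n + 2 * (m + 1 + (m + 1) + 1) = n + 2 * (m + 1 + (m + 1) + 1)) Q)) := by
  have h𝒳 := hf.isSmoothProjective_total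
  have hY := hY⟦hf⟧
  have hμ := hasPoincareDuality_complexOrientationFamily
  have h12a : (θ₁ ≫ θ₂) ≫ 𝐚[f] = 𝐚[f] ≫ ν := by rw [Category.assoc, h2a, h1a]
  have h12b : (θ₁ ≫ θ₂) ≫ 𝐛[f] = 𝐛[f] ≫ ν := by rw [Category.assoc, h2b, ← Category.assoc, h1b]
  rw [← LinearMap.comp_apply, ← complexGysin_comp hμ hY h𝒳 h𝒳 𝐚[f] ν hc rfl, ← h12a,
    complexGysin_comp hμ hY hY h𝒳 (θ₁ ≫ θ₂) 𝐚[f] (rfl : kn + 2 * (m + 1 + (m + 1) + 1) = kn + 2 * (m + 1 + (m + 1) + 1)) hc,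
    LinearMap.comp_apply]
  congr 1
  have hby : complexBetti.map 𝐛[f] k (complexBetti.map ν k y) = complexBetti.map (θ₁ ≫ θ₂) k (complexBetti.map 𝐛[f] k y) := by
    rw [← complexBetti.map_comp_apply', ← complexBetti.map_comp_apply', h12b]
  rw [hby]
  exact complexGysin_cup hμ hY hY (θ₁ ≫ θ₂) hkn rfl rfl hkn (complexBetti.map 𝐛[f] k y) Q

/-- **`(θ₁θ₂)_* 1 = N^{2d} N^{2d} · 1`** on the fibre square (`(θ₁θ₂)_* = θ_{2*} θ_{1*}` and part XXXVII-d's degrees).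
[cite: Fulton1998, Example 1.7.4] [cite: MumfordAV1970, §19] -/
theorem gysin_squareEndo_comp_one (hf : IsCompactAbelianPencil f (m + 1)) (t : ComplexPoints S) (ν : 𝒳 ⟶ 𝒳) (hν : ν ≫ f = f) (N : ℕ)
    (hθt : ∃ (νs : fiberOver f t ⟶ fiberOver f t) (A : AbelianVariety ℂ) (e : A.X ≅ fiberOver f t),
      νs ≫ fiberι f t = fiberι f t ≫ ν ∧ e.hom ≫ νs = (N • 𝟙 A).hom.hom.hom ≫ e.hom)
    {θ₁ θ₂ : 𝒴[f] ⟶ 𝒴[f]} (h1a : θ₁ ≫ 𝐚[f] = 𝐚[f] ≫ ν) (h1b : θ₁ ≫ 𝐛[f] = 𝐛[f])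
    (h2a : θ₂ ≫ 𝐚[f] = 𝐚[f]) (h2b : θ₂ ≫ 𝐛[f] = 𝐛[f] ≫ ν) :
    complexGysin complexOrientationFamily hY⟦hf⟧ hY⟦hf⟧ (θ₁ ≫ θ₂)
      (rfl : 0 + 2 * (m + 1 + (m + 1) + 1) = 0 + 2 * (m + 1 + (m + 1) + 1)) (singularCohomology.one ℂ (ComplexPoints 𝒴[f])) =
      ((N : ℂ) ^ (2 * (m + 1) + 2 * (m + 1))) • singularCohomology.one ℂ (ComplexPoints 𝒴[f]) := by
  have hY := hY⟦hf⟧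
  have hμ := hasPoincareDuality_complexOrientationFamily
  rw [complexGysin_comp hμ hY hY hY θ₁ θ₂ rfl rfl, LinearMap.comp_apply, gysin_squareEndo_fst_one hf t ν N hθt h1a h1b, map_smul,
    gysin_squareEndo_snd_one hf t ν hν N hθt h2a h2b, smul_smul, ← pow_add, add_comm]

end Shift

end Summit.HodgeConjecture.HodgeConjecture.Ring2.AbelianAll

end
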